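import Mathlib
import Summits.ResolutionOfSingularities.ResolutionOfSingularities.Theorems.RadicialJungCleanModelsCleanPointBlowupChart
import HarnessLib

/-!
# Route `RadicialJung`, crux `CleanModels` (stmt-ResolutionOfSingularities-15917), line `Sketch` rev 14, stub 4d
# `stub_cleanPointBlowup`: the chart computation, II (form (1); the Rees chart)

Continuation of `RadicialJungCleanModelsCleanPointBlowupChart.lean` (same abstract chart data `(A, ψ, u_i, ε, 𝔓, L)` of the
blowing up of a regular local ring `R` at its closed point in the `t_j`-chart).  PROVED here:

* `looseCleanForm_chart_of_form_one` — **form (1) survives**: `Y = f'(ψ(u ∏_{i<m} t_i^{a_i}))` (`p ∤ a_i`) becomes, up to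
  the `p`-th power `f'(ψ t_j)^{-A}` when `p ∣ A = Σ a_i`, loosely clean at `L` (the charged fractions `u_i ∈ 𝔓` together
  with `ψ(t_j)` are part of a regular system of parameters of `L`, `isRsopPart_chartFamily` of `BlowupChartRsop.lean`; if none
  is charged and `p ∣ A`, the unit `U = ψ(u) ∏ u_i^{a_i}` has `D Ū = a_{i₀} Ū ≠ 0` for the Euler derivation
  `T_{i₀} ∂/∂T_{i₀}` of the exceptional chart, and the Leibniz obstruction applies);
* `looseCleanForm_reesChart_of_form_one`, `looseCleanForm_reesChart_of_form_two` — the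
  specialisation to the Rees chart `A = (R[𝔪t])_{(t_j t)}` (`chartRing`, `chartBase`, `chartGen`, `chartQuotEquiv`), with
  `L` any localisation at a prime over `𝔪` presented by a ring map `χ` (the format of `IsBlowup.exists_reesChart_stalk`).

Honest framing: nothing here proves resolution in characteristic `p` or any case of `CleanModels`.
-/

noncomputable section

set_option linter.dupNamespace false -- mandated namespace of this single-conjunct summit

open IsLocalRing MvPolynomial
open Literature.AlgebraicGeometry.Resolution

namespace Summit.ResolutionOfSingularities.ResolutionOfSingularities.Theorems.RadicialJung.CleanModels

universe u

/-! ## Abstract chart data (continued) -/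

section AbstractChart

variable {R : Type u} [CommRing R] [IsRegularLocalRing R] {d : ℕ} (t : Fin d → R) (j : Fin d)
  (hspan : Ideal.span (Set.range t) = maximalIdeal R) (hdim : ringKrullDim R = (d : WithBot ℕ∞))
  {A : Type u} [CommRing A] (ψ : R →+* A) (uA : Fin d → A)
  (hrel : ∀ i, ψ (t i) = ψ (t j) * uA i) (hnzd : ψ (t j) ∈ nonZeroDivisors A)
  (ε : MvPolynomial {i : Fin d // i ≠ j} (R ⧸ Ideal.span (Set.range t)) ≃+* A ⧸ Ideal.span {ψ (t j)})
  (hεC : ∀ r : R, ε (C (Ideal.Quotient.mk (Ideal.span (Set.range t)) r)) = Ideal.Quotient.mk _ (ψ r))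
  (hεX : ∀ i : {i : Fin d // i ≠ j}, ε (X i) = Ideal.Quotient.mk _ (uA i.1))
  (𝔓 : Ideal A) [𝔓.IsPrime] (h𝔓 : 𝔓.comap ψ = maximalIdeal R)
  (L : Type u) [CommRing L] [IsLocalRing L] [Algebra A L] [IsLocalization.AtPrime L 𝔓]
  (p : ℕ) [hp : Fact p.Prime]

/-! ### Form (1) survives -/

include hspan hdim hrel hnzd hεC hεX h𝔓 in
/-- **Form (1) survives the blowing up** (up to a `p`-th power twist).  If `Y = f'(ψ(u ∏_{i<m} t_i^{a_i}))` with `u` a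
unit, `0 < m` and `p ∤ a_i`, then `e^p Y` is loosely clean at `L` for some `e ≠ 0`: in the chart,
`ψ(u ∏ t_i^{a_i}) = ψ(t_j)^A · ψ(u) ∏ u_i^{a_i}` (`A = Σ a_i`); the fractions `u_i ∈ 𝔓` («charged») together with `ψ(t_j)`
are part of a regular system of parameters of `L` (`isRsopPart_chartFamily`), the others are units.  If `p ∤ A` this is
form (1) (`e = 1`); if `p ∣ A`, twist by `e = f'(ψ t_j)^{-A/p}`: form (1) in the charged fractions if there are any, and
otherwise the unit `U = ψ(u) ∏ u_i^{a_i}` is loosely clean by the Leibniz obstruction with the Euler derivation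
`T_{i₀} ∂/∂T_{i₀}` of the exceptional chart (`D Ū = a_{i₀} Ū ≠ 0`; an index `i₀` with `t_{i₀} ≠ t_j` exists as `p ∣ A`
forces `m ≥ 2`). [cite: Piltant2013, §2 Axiom 2 (ii)] -/
theorem looseCleanForm_chart_of_form_one [IsNoetherianRing A] [CharP R p] {F' : Type u} [Field F'] (f' : L →+* F')
    (hf' : Function.Injective f') {m : ℕ} (hmd : m ≤ d) (hm : 0 < m) (a : Fin m → ℕ) (ha : ∀ i, ¬ p ∣ a i) {u : R}
    (hu : IsUnit u) {Y : F'} (hY : Y = f' (algebraMap A L (ψ (u * ∏ i : Fin m, t (Fin.castLE hmd i) ^ a i)))) :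
    ∃ e : F', e ≠ 0 ∧ LooseCleanForm p f' (e ^ p * Y) := by
  classical
  have hP : 𝔓.IsPrime := ‹_›
  -- (i) `ψ (u ∏ t_i^{a_i}) = ψ(t_j)^A · (ψ u ∏ u_i^{a_i})`
  have hψ : ψ (u * ∏ i : Fin m, t (Fin.castLE hmd i) ^ a i) =
      ψ (t j) ^ (∑ i, a i) * (ψ u * ∏ i : Fin m, uA (Fin.castLE hmd i) ^ a i) := by
    rw [map_mul, map_prod]
    have h1 : ∏ i : Fin m, ψ (t (Fin.castLE hmd i) ^ a i) = ∏ i : Fin m, (ψ (t j) ^ a i * uA (Fin.castLE hmd i) ^ a i) :=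
      Finset.prod_congr rfl fun i _ => by rw [map_pow, hrel (Fin.castLE hmd i), mul_pow]
    rw [h1, Finset.prod_mul_distrib, Finset.prod_pow_eq_pow_sum]
    ring
  -- `T = ψ(t_j)/1 ≠ 0` in `L`, hence `f' T ≠ 0`
  have hT0 : algebraMap A L (ψ (t j)) ≠ 0 :=
    nonZeroDivisors.ne_zero (algebraMap_centre_mem_nonZeroDivisors t j L ψ hnzd 𝔓)
  have hfT0 : f' (algebraMap A L (ψ (t j))) ≠ 0 := (map_ne_zero_iff f' hf').mpr hT0
  -- (ii) the charged set `N` and the unit part `bU`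
  set N : Finset (Fin m) := Finset.univ.filter (fun i => uA (Fin.castLE hmd i) ∈ 𝔓) with hN
  set bU : A := ψ u * ∏ i ∈ Finset.univ.filter (fun i => ¬ uA (Fin.castLE hmd i) ∈ 𝔓),
    uA (Fin.castLE hmd i) ^ a i with hbU
  have hbU𝔓 : bU ∉ 𝔓 := by
    intro h
    rcases hP.mem_or_mem h with h1 | h1
    · exact hP.ne_top' (Ideal.eq_top_of_isUnit_mem 𝔓 h1 (hu.map ψ))
    · rw [Ideal.IsPrime.prod_mem_iff] at h1
      obtain ⟨i, hi, hi'⟩ := h1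
      exact (Finset.mem_filter.mp hi).2 (hP.mem_of_pow_mem _ hi')
  have hbUunit : IsUnit (algebraMap A L bU) := IsLocalization.map_units L (⟨bU, hbU𝔓⟩ : 𝔓.primeCompl)
  have hsplit : algebraMap A L (ψ u * ∏ i : Fin m, uA (Fin.castLE hmd i) ^ a i) =
      algebraMap A L bU * ∏ i ∈ N, algebraMap A L (uA (Fin.castLE hmd i)) ^ a i := by
    rw [hbU, ← Finset.prod_filter_mul_prod_filter_not Finset.univ (fun i => uA (Fin.castLE hmd i) ∈ 𝔓)]
    simp only [map_mul, map_prod, map_pow]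
    ring
  have hY' : Y = f' (algebraMap A L (ψ (t j))) ^ (∑ i, a i) *
      f' (algebraMap A L bU * ∏ i ∈ N, algebraMap A L (uA (Fin.castLE hmd i)) ^ a i) := by
    rw [hY, hψ, map_mul (algebraMap A L), map_pow (algebraMap A L), hsplit, map_mul f', map_pow f']
  -- (iii) enumerate the charged set; the chart family `(T, charged fractions)` is part of a rsop of `L`
  let emb : Fin N.card ↪o Fin m := N.orderEmbOfFin rfl
  have hembN : ∀ k, uA (Fin.castLE hmd (emb k)) ∈ 𝔓 := fun k =>
    (Finset.mem_filter.mp (N.orderEmbOfFin_mem rfl k)).2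
  have huj : uA j = 1 := chartFrac_self t j ψ uA hrel hnzd
  have hne : ∀ k, Fin.castLE hmd (emb k) ≠ j := by
    intro k h
    have h1 := hembN k
    rw [h, huj] at h1
    exact hP.ne_top' ((Ideal.eq_top_iff_one 𝔓).mpr h1)
  obtain ⟨jJ, hjJv⟩ : ∃ jJ : Fin N.card → {i : Fin d // i ≠ j}, ∀ k, (jJ k).1 = Fin.castLE hmd (emb k) :=
    ⟨fun k => ⟨Fin.castLE hmd (emb k), hne k⟩, fun k => rfl⟩
  have hjJ : Function.Injective jJ := fun k k' h =>
    emb.injective (Fin.castLE_injective hmd (by rw [← hjJv k, ← hjJv k', h]))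
  have hrsop : IsRsopPart (chartFamily t j Fin.elim0 L ψ uA jJ) :=
    isRsopPart_chartFamily t j Fin.elim0 (span_range_append_elim0 t hspan) (spanFinrank_eq_add_zero hdim) L ψ uA hnzd
      ε hεC hεX 𝔓 h𝔓 jJ hjJ (fun k => by rw [hjJv]; exact hembN k)
  have hprodN : ∏ i ∈ N, algebraMap A L (uA (Fin.castLE hmd i)) ^ a i =
      ∏ k : Fin N.card, algebraMap A L (uA (Fin.castLE hmd (emb k))) ^ a (emb k) := by
    have hmap : (Finset.univ : Finset (Fin N.card)).map emb.toEmbedding = N := by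
      apply Finset.coe_injective
      rw [Finset.coe_map, Finset.coe_univ, Set.image_univ]
      exact N.range_orderEmbOfFin rfl
    rw [← Finset.prod_congr hmap (fun _ _ => rfl), Finset.prod_map]
    rfl
  -- (iv) cases on `p ∣ A`
  by_cases hpA : p ∣ ∑ i, a i
  · -- twist by the `p`-th power `f'(T)^{-A}`
    obtain ⟨q, hq⟩ := hpA
    refine ⟨(f' (algebraMap A L (ψ (t j))) ^ q)⁻¹, inv_ne_zero (pow_ne_zero _ hfT0), ?_⟩
    have hYe : ((f' (algebraMap A L (ψ (t j))) ^ q)⁻¹) ^ p * Y =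
        f' (algebraMap A L bU * ∏ i ∈ N, algebraMap A L (uA (Fin.castLE hmd i)) ^ a i) := by
      rw [hY', hq, inv_pow, ← pow_mul, mul_comm q p, inv_mul_cancel_left₀ (pow_ne_zero _ hfT0)]
    by_cases hNe : N = ∅
    · -- no charged fraction: the unit `b = ψ(u) ∏ u_i^{a_i}` has the Leibniz property
      have hN' : ∀ i : Fin m, uA (Fin.castLE hmd i) ∉ 𝔓 := fun i hi => by
        have h1 : i ∈ N := Finset.mem_filter.mpr ⟨Finset.mem_univ _, hi⟩
        rw [hNe] at h1
        exact Finset.notMem_empty _ h1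
      -- an index `i₀` off the chart coordinate (else `m = 1` and `p ∣ a₀`)
      obtain ⟨i₀, hi₀⟩ : ∃ i₀ : Fin m, Fin.castLE hmd i₀ ≠ j := by
        by_contra hall
        push Not at hall
        have hsub : ∀ i i' : Fin m, i = i' := fun i i' =>
          Fin.castLE_injective hmd (by rw [hall i, hall i'])
        have hm1 : m = 1 := by
          refine le_antisymm ?_ hm
          by_contra h
          push Not at h
          exact absurd (hsub ⟨0, hm⟩ ⟨1, h⟩) (by simp [Fin.ext_iff])
        subst hm1
        apply ha 0
        have h1 : ∑ i : Fin 1, a i = a 0 := by simp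
        rw [← h1]
        exact ⟨q, hq⟩
      have hb𝔓 : ψ u * ∏ i : Fin m, uA (Fin.castLE hmd i) ^ a i ∉ 𝔓 := by
        intro h
        rcases hP.mem_or_mem h with h1 | h1
        · exact hP.ne_top' (Ideal.eq_top_of_isUnit_mem 𝔓 h1 (hu.map ψ))
        · rw [Ideal.IsPrime.prod_mem_iff] at h1
          obtain ⟨i, -, hi'⟩ := h1
          exact hN' i (hP.mem_of_pow_mem _ hi')
      -- the prime of the point on the exceptional chart and the Euler derivation `T_{i₀} ∂/∂T_{i₀}`
      haveI := isMaximal_span_rsop t hspan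
      letI : Field (R ⧸ Ideal.span (Set.range t)) := Ideal.Quotient.field _
      haveI := charP_quotient_span_rsop t hspan p
      obtain ⟨Q, hQprime, hQ⟩ := exists_prime_comap_chartReduction t j hspan ψ ε 𝔓 h𝔓
      haveI := hQprime
      let i₀' : {i : Fin d // i ≠ j} := ⟨Fin.castLE hmd i₀, hi₀⟩
      obtain ⟨D, hDC, hDX⟩ := MvPolynomial.exists_derivation_C_eq_X_eq (σ := {i : Fin d // i ≠ j})
        (T := MvPolynomial {i : Fin d // i ≠ j} (R ⧸ Ideal.span (Set.range t)))
        (0 : Derivation ℤ (R ⧸ Ideal.span (Set.range t))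
          (MvPolynomial {i : Fin d // i ≠ j} (R ⧸ Ideal.span (Set.range t))))
        (fun i => if i = i₀' then X i₀' else 0)
      refine looseCleanForm_unit_of_chart t j hspan ψ ε 𝔓 L p f' Q hQ D _ hb𝔓 ?_ (hYe.trans (by rw [← hsplit]))
      -- `D (b̄) = a_{i₀} b̄ ∉ Q`
      set φE := ε.symm.toRingHom.comp (Ideal.Quotient.mk (Ideal.span {ψ (t j)})) with hφE
      have hred : φE (ψ u * ∏ i : Fin m, uA (Fin.castLE hmd i) ^ a i) =
          C (Ideal.Quotient.mk (Ideal.span (Set.range t)) u) * ∏ i : Fin m, φE (uA (Fin.castLE hmd i)) ^ a i := by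
        rw [map_mul, map_prod, hφE, chartReduction_map t j ψ ε hεC u]
        simp only [map_pow]
      have hy : ∀ i : Fin m, D (φE (uA (Fin.castLE hmd i))) =
          if i = i₀ then φE (uA (Fin.castLE hmd i)) else 0 := by
        intro i
        by_cases hij : Fin.castLE hmd i = j
        · have hii₀ : i ≠ i₀ := fun h => hi₀ (h ▸ hij)
          rw [if_neg hii₀, hij, huj, map_one]
          change D 1 = 0
          exact D.map_one_eq_zero
        · have hX : φE (uA (Fin.castLE hmd i)) = X ⟨Fin.castLE hmd i, hij⟩ :=
            chartReduction_frac t j ψ uA ε hεX ⟨Fin.castLE hmd i, hij⟩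
          rw [hX]
          change D (X _) = _
          rw [hDX]
          by_cases hii₀ : i = i₀
          · subst hii₀
            rw [if_pos rfl, if_pos rfl]
          · have hne' : (⟨Fin.castLE hmd i, hij⟩ : {i : Fin d // i ≠ j}) ≠ i₀' := fun h =>
              hii₀ (Fin.castLE_injective hmd (congrArg Subtype.val h))
            rw [if_neg hne', if_neg hii₀]
      have hx : D (C (Ideal.Quotient.mk (Ideal.span (Set.range t)) u)) = 0 := by
        rw [hDC]
        rfl
      have hDb : D (φE (ψ u * ∏ i : Fin m, uA (Fin.castLE hmd i) ^ a i)) =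
          (a i₀ : MvPolynomial {i : Fin d // i ≠ j} (R ⧸ Ideal.span (Set.range t))) *
            φE (ψ u * ∏ i : Fin m, uA (Fin.castLE hmd i) ^ a i) := by
        rw [hred]
        exact derivation_apply_mul_prod_pow_eq D _ a i₀ hy hx
      change D (φE _) ∉ Q
      rw [hDb]
      intro h
      rcases hQprime.mem_or_mem h with h1 | h1
      · have ha0 : ((a i₀ : ℕ) : R ⧸ Ideal.span (Set.range t)) ≠ 0 :=
          fun h0 => ha i₀ ((CharP.cast_eq_zero_iff (R ⧸ Ideal.span (Set.range t)) p (a i₀)).mp h0)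
        have hunit : IsUnit ((a i₀ : ℕ) : MvPolynomial {i : Fin d // i ≠ j} (R ⧸ Ideal.span (Set.range t))) := by
          rw [← map_natCast C]
          exact (isUnit_iff_ne_zero.mpr ha0).map C
        exact hQprime.ne_top' (Ideal.eq_top_of_isUnit_mem Q h1 hunit)
      · have h2 : ψ u * ∏ i : Fin m, uA (Fin.castLE hmd i) ^ a i ∈ Q.comap φE := Ideal.mem_comap.mpr h1
        rw [hQ] at h2
        exact hb𝔓 h2
    · -- some charged fraction: form (1) in the charged fractions
      have hn0 : 0 < N.card := Finset.card_pos.mpr (Finset.nonempty_iff_ne_empty.mpr hNe)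
      have hz : IsRsopPart (fun k : Fin N.card => algebraMap A L (uA (Fin.castLE hmd (emb k)))) := by
        have h1 := hrsop.comp (fun k : Fin N.card => Fin.succ (Fin.castAdd 0 k)) fun k k' h => by
          simpa [Fin.ext_iff] using h
        have h2 : (chartFamily t j Fin.elim0 L ψ uA jJ ∘ fun k : Fin N.card => Fin.succ (Fin.castAdd 0 k)) =
            fun k => algebraMap A L (uA (Fin.castLE hmd (emb k))) := by
          funext k
          rw [Function.comp_apply, chartFamily, Fin.cons_succ]
          exact (Fin.append_left _ _ k).trans (by rw [hjJv])
        rwa [h2] at h1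
      exact looseCleanForm_one_of_isRsopPart p f' hz hn0 (fun k => a (emb k)) (fun k => ha _) hbUunit
        (by rw [hYe, hprodN])
  · -- `p ∤ A`: form (1) with `T` and the charged fractions
    refine ⟨1, one_ne_zero, ?_⟩
    rw [one_pow, one_mul]
    refine looseCleanForm_one_of_isRsopPart p f' hrsop (Nat.succ_pos _)
      (Fin.cons (∑ i, a i) (Fin.append (fun k => a (emb k)) Fin.elim0)) ?_ hbUunit ?_
    · intro k
      refine Fin.cases ?_ (fun k => ?_) k
      · rw [Fin.cons_zero]; exact hpA
      · rw [Fin.cons_succ, Fin.append_elim0, Function.comp_apply]; exact ha _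
    · have hprod : ∏ k : Fin (N.card + 0 + 1), chartFamily t j Fin.elim0 L ψ uA jJ k ^
          (Fin.cons (∑ i, a i) (Fin.append (fun k => a (emb k)) Fin.elim0) : Fin (N.card + 0 + 1) → ℕ) k =
          algebraMap A L (ψ (t j)) ^ (∑ i, a i) *
            ∏ k : Fin N.card, algebraMap A L (uA (Fin.castLE hmd (emb k))) ^ a (emb k) := by
        rw [Fin.prod_univ_succ, chartFamily]
        simp only [Fin.cons_zero, Fin.cons_succ]
        congr 1
        refine Finset.prod_congr rfl fun k _ => ?_
        rw [Fin.append_right_nil _ _ rfl, Fin.append_elim0]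
        simp [hjJv]
      rw [hY', hprod, hprodN, ← map_pow, ← map_mul]
      congr 1
      ring

end AbstractChart

/-! ## The Rees chart `(R[𝔪t])_{(t_j t)}` is an abstract chart datum -/

section ReesChart

variable {R : Type u} [CommRing R] [IsRegularLocalRing R] {d : ℕ} (t : Fin d → R) (j : Fin d)
  (hspan : Ideal.span (Set.range t) = maximalIdeal R) (hdim : ringKrullDim R = (d : WithBot ℕ∞))
  (𝔴 : Ideal (chartRing t j)) [𝔴.IsPrime] (h𝔴 : 𝔴.comap (chartBase t j) = maximalIdeal R)
  (L : Type u) [CommRing L] [IsLocalRing L] (χ : chartRing t j →+* L)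
  (hloc : @IsLocalization.AtPrime _ _ L _ χ.toAlgebra 𝔴 _)
  (p : ℕ) [hp : Fact p.Prime] [CharP R p]

include hspan hdim h𝔴 hloc in
/-- **Form (1) survives, Rees chart** (`looseCleanForm_chart_of_form_one` for `A = (R[𝔪t])_{(t_j t)}`, `ψ = chartBase`,
`u_i = chartGen`, `ε = chartQuotEquiv`, `L = A_𝔴` presented by `χ`). [cite: Piltant2013, §2 Axiom 2 (ii)] -/
theorem looseCleanForm_reesChart_of_form_one {F' : Type u} [Field F'] (f' : L →+* F')
    (hf' : Function.Injective f') {m : ℕ} (hmd : m ≤ d) (hm : 0 < m) (a : Fin m → ℕ) (ha : ∀ i, ¬ p ∣ a i) {u : R}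
    (hu : IsUnit u) {Y : F'} (hY : Y = f' (χ (chartBase t j (u * ∏ i : Fin m, t (Fin.castLE hmd i) ^ a i)))) :
    ∃ e : F', e ≠ 0 ∧ LooseCleanForm p f' (e ^ p * Y) := by
  letI := χ.toAlgebra
  haveI := hloc
  haveI := isNoetherianRing_blowupChart t j
  exact looseCleanForm_chart_of_form_one t j hspan hdim (chartBase t j) (chartGen t j)
    (reesChartBase_apply_eq_mul_chartGen t j) (reesChartBase_mem_nonZeroDivisors _ _)
    (chartQuotEquiv t j (isQuasiRegular_centre t Fin.elim0 (span_range_append_elim0 t hspan)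
      (spanFinrank_eq_add_zero hdim))) (chartQuotMap_C t j) (chartQuotMap_X t j) 𝔴 h𝔴 L p f' hf' hmd hm a ha hu hY

include hspan hdim h𝔴 hloc in
/-- **Form (2) survives, Rees chart** (`looseCleanForm_chart_of_form_two` for `A = (R[𝔪t])_{(t_j t)}`).
[cite: Piltant2013, §2 Axiom 2 (ii)] -/
theorem looseCleanForm_reesChart_of_form_two {F' : Type*} [CommRing F'] (f' : L →+* F') {u : R} (hu : IsUnit u)
    (hup : ∀ c : R, u - c ^ p ∉ maximalIdeal R) {Y : F'} (hY : Y = f' (χ (chartBase t j u))) :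
    LooseCleanForm p f' Y := by
  letI := χ.toAlgebra
  haveI := hloc
  exact looseCleanForm_chart_of_form_two t j hspan (chartBase t j)
    (chartQuotEquiv t j (isQuasiRegular_centre t Fin.elim0 (span_range_append_elim0 t hspan)
      (spanFinrank_eq_add_zero hdim))) (chartQuotMap_C t j) 𝔴 h𝔴 L p f' hu hup hY

end ReesChart

end Summit.ResolutionOfSingularities.ResolutionOfSingularities.Theorems.RadicialJung.CleanModels

end
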